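import Mathlib
import HarnessLib
import Literature.MathematicalPhysics.QuantumLattice.SectorisedIncrementBoundBinomialWeightedPlateauSubLaplacian
import Summits.HubbardSuperconductivity.HubbardSuperconductivity.Theorems.KLProgrammeKLRegimeEngineTowerBlockStepWt

/-!
# Route `KLProgramme` — crux K3 ENGINE (stmt-HubbardSuperconductivity-20437 `KLRegimeEngineV17F2`), stub (b) / E1 interface (E2) in-tower route, located item
# «(E2)-ROUTE-TADPOLE»: THE BINOMIAL WEIGHTED DOOR AT A BLOCK STEP WITHOUT ITS ONE-LINE TERM, one pinned leg (the other sectors summed) — the twin of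
# `blockStep_firstOrder_wt_le` (…EngineTowerBlockStepWt) for `e^{Δ_Γ}G − G − Δ_Γ G`
# (recipe «(E2)-POW3-TRACK» option (i), `klWtPinnedSumPow`-currency layer N2; cell gate-hubbard-kl, seat hubbard-kl-k3c3-p2 g19)

The prescribed-output version is `blockStep_geTwoLines_wtFull_le` (…TowerBlockStepWtFullSubTadpole).  Here the one-pinned-leg version, on the same block geometry
`Γ = C^K_{(Λ_{J₂},Λ_{J₁}]}`, thin/fat families and plateau facts as `blockStep_firstOrder_wt_le`, supplier
`sum_wt_norm_sectorAnalysis_gaussConv_sub_sub_laplacian_le_binomial_of_plateau` (Literature):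

* **`blockStep_geTwoLines_wt_le`** — `blockStep_firstOrder_wt_le` verbatim with `e^{Δ_Γ}G − G − Δ_Γ G` on the left and the binomial–Gram sum over `m′ > p + 2` on the right.
Composition of landed theorems; nothing about the model is asserted beyond them; nothing asserts (E2), any stub, K3 or superconductivity.
References: BGM 2006 (2.61)–(2.63), (2.66), (2.86)–(2.90), §2.7 (2.70)–(2.71a), §3 (3.2)–(3.8) [cite: BenfattoGiulianiMastropietro2006].
-/

noncomputable section

namespace Summit.HubbardSuperconductivity.HubbardSuperconductivity.Theorems.EngineV8

set_option linter.dupNamespace false -- summit = problem name (single-conjunct summit), D-0017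

open Real Finset Literature.MathematicalPhysics.QuantumLattice Literature.Probability.LatticeModels GrassmannAlgebra
open Summit.HubbardSuperconductivity.HubbardSuperconductivity.Theorems.KLProgrammeLegKernels
open Summit.HubbardSuperconductivity.HubbardSuperconductivity.Theorems.KLRegimeSplit
open Summit.HubbardSuperconductivity.HubbardSuperconductivity.Theorems.KLRegimeWick
open Summit.HubbardSuperconductivity.HubbardSuperconductivity.Theorems.TwoPointAssembly
open Literature.Probability.LatticeModels.BattleFederbush

variable {L M : ℕ} [NeZero L] [NeZero M] {Λ : Type*} [DecidableEq Λ] {wt : Finset Λ → ℝ}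

/-- **THE BINOMIAL WEIGHTED DOOR AT A BLOCK STEP WITHOUT ITS ONE-LINE TERM, one pinned leg** (`e^{Δ_Γ}G − G − Δ_Γ G`: at least two self-contractions); geometry and
constants as `blockStep_firstOrder_wt_le`; the right side sums over the input degrees `m′ > p + 2` only.
[cite: BenfattoGiulianiMastropietro2006, (2.61)-(2.63), (2.66), (2.86)-(2.90), (3.2)-(3.8)] -/
theorem blockStep_geTwoLines_wt_le (hwt : IsTreeWeight wt) {β : ℝ} (hβ : 0 < β) (μ : ℝ) (K : TrigPolyC4v) {J₁ J₂ J' : ℕ}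
    (hJ₁ : 1 ≤ J₁) (hJ : J₁ ≤ J₂) (hJ' : J₁ ≤ J')
    (πi : SpaceTimeIdx L M × SectorLeg (sectorCount (J₁ - 1)) → Λ) (πo : SpaceTimeIdx L M × SectorLeg (sectorCount J') → Λ)
    (G : HubbardGrassmann L M) (hG : G ∈ evenPart ℂ (HubbardFieldIdx L M))
    {κ : ℝ} (hκ : 0 ≤ κ)
    (hGB : IsGramBoundedR ((sectorSubMatrix L M β (bgmFatMultiplier L M klE0 β (nambuXiCT L μ K) (J₁ - 1))).transpose *
      hubbardCovSliceCT L M β μ 0 K (klScale klE0 J₂) (klScale klE0 J₁) *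
        sectorSubMatrix L M β (bgmFatMultiplier L M klE0 β (nambuXiCT L μ K) (J₁ - 1))) κ)
    (B : ℕ → ℝ) (hB0 : ∀ m', 0 ≤ B m')
    (hB : ∀ (m' : ℕ) (j : Fin (2 * m')) (w : SpaceTimeIdx L M × SectorLeg (sectorCount (J₁ - 1))),
      ∑ Y ∈ univ.filter (fun Y : Fin (2 * m') → SpaceTimeIdx L M × SectorLeg (sectorCount (J₁ - 1)) => Y j = w),
        wt ((univ.image Y).image πi) *
          ‖kernel ℂ (ExteriorAlgebra.map (Matrix.toLin' (sectorAnalysisMatrix L M β (klAnisoFamily L M β μ K klE0 (J₁ - 1)))) G) (2 * m') Y‖ ≤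
        B m')
    {cr cc : ℝ} (hcc0 : 0 ≤ cc)
    (hrow' : ∀ X'', ∑ X', ‖(sectorAnalysisMatrix L M β (klAnisoFamily L M β μ K klE0 J') *
        sectorSubMatrix L M β (bgmFatMultiplier L M klE0 β (nambuXiCT L μ K) (J₁ - 1))) X'' X'‖ * wt {πo X'', πi X'} ≤ cr)
    (hcol' : ∀ X', ∑ X'', ‖(sectorAnalysisMatrix L M β (klAnisoFamily L M β μ K klE0 J') *
        sectorSubMatrix L M β (bgmFatMultiplier L M klE0 β (nambuXiCT L μ K) (J₁ - 1))) X'' X'‖ * wt {πo X'', πi X'} ≤ cc)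
    (p : ℕ) (q : Fin (2 * (p + 1))) (w'' : SpaceTimeIdx L M × SectorLeg (sectorCount J')) :
    ∑ X'' ∈ univ.filter (fun X'' : Fin (2 * (p + 1)) → SpaceTimeIdx L M × SectorLeg (sectorCount J') => X'' q = w''),
        wt ((univ.image X'').image πo) *
          ‖kernel ℂ (ExteriorAlgebra.map (Matrix.toLin' (sectorAnalysisMatrix L M β (klAnisoFamily L M β μ K klE0 J')))
            (gaussConv ℂ (hubbardCovSliceCT L M β μ 0 K (klScale klE0 J₂) (klScale klE0 J₁)) G - G -
              grassmannLaplacian ℂ (hubbardCovSliceCT L M β μ 0 K (klScale klE0 J₂) (klScale klE0 J₁)) G)) (2 * (p + 1)) X''‖ ≤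
      cr * cc ^ (2 * p + 1) *
        ∑ m' ∈ range (Fintype.card (SpaceTimeIdx L M × SectorLeg (sectorCount (J₁ - 1))) / 2 + 1),
          (if p + 1 + 1 < m' then ((2 * m').choose (2 * (p + 1)) : ℝ) * κ ^ (2 * m' - 2 * (p + 1)) *
            (imagTimeWeight β M ^ (2 * m') * B m') else 0) := by
  have he : (0 : ℝ) < klE0 := by norm_num [klE0]
  exact sum_wt_norm_sectorAnalysis_gaussConv_sub_sub_laplacian_le_binomial_of_plateau hwt πi πo hβ
    (klAnisoFamily L M β μ K klE0 (J₁ - 1)) (bgmFatMultiplier L M klE0 β (nambuXiCT L μ K) (J₁ - 1))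
    (fun ω k => bgmFatMultiplier_mul_bgmMultiplier he β (nambuXiCT L μ K) (J₁ - 1) ω k)
    (fun k hk ω => klAnisoFamily_eq_zero_of_sum_eq_zero β μ K klE0 (J₁ - 1) k hk ω)
    (klAnisoFamily L M β μ K klE0 J') G hG _
    (fun X Y hXY => sum_klAnisoFamily_eq_one_of_blockSliceCT_ne_zero β μ K hJ₁ hJ X Y hXY)
    (fun ω' k hne => sum_klAnisoFamily_pred_eq_one_of_klAnisoFamily_ne_zero β μ K hJ₁ hJ' ω' k hne)
    hκ hGB B hB0 hB hcc0 hrow' hcol' p q w''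


end Summit.HubbardSuperconductivity.HubbardSuperconductivity.Theorems.EngineV8

end
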